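import Summits.BirchSwinnertonDyer.Rank1Residual.AdditivePotMult.QuadraticTwistTamagawaTypeIVFlipTwo
import Summits.BirchSwinnertonDyer.Rank1Residual.AdditivePotMult.QuadraticBaseChangeTamagawaTypeIVInert
import Literature.NumberTheory.LFunctions.ChebotarevCrossingPushDown
import Literature.RingTheory.DiscreteValuationRing.AdicCompletionResidueField
import Literature.NumberTheory.EllipticCurves.QuadraticTwistMinimalModelProofs
import HarnessLib

/-!
# The type-`IV` / `IV*` Tamagawa FLIP at the place of `ℚ` above `2` (row T-MIL-B2, file B2-2)

HONEST FRAMING (cell `b2b-bsdres`, verbatim): research route; TOOL theorems only; 0 defs / 0 facts /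
0 sorry; nothing booked; no mark / label moved; X3♯(M)/X4(M) stay CONSTRUCTION-SHAPED.

At an inert place `ℓ = 2` (residue field `𝔽₂`; `K = ℚ(√d)`, `d ≡ 5 (mod 8)`, e.g. `d = −3`) of
Kodaira type `IV` / `IV*` the unit twist is given by the tree's integral twist model
`WeierstrassCurve.twistModel k` (`d = 4k + 1`).  For a `IV` normal form `J` (`a₃ = ϖγ`,
`a₆ = ϖ²ε`, `γ̄ ≠ 0`) the twist model is again a `IV` normal form with `γ' = dγ`,
`ε' = d³ε + k d²γ²`; over `𝔽₂` (`d̄ = 1`, `k̄ = 1` for `d ≡ 5 mod 8`, `γ̄ = 1`) the Step-5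
quadratics are `Y² + Y + ε̄` and `Y² + Y + (ε̄ + 1)`: exactly one has a root (Artin–Schreier), so
`{c(W), c(W^{(d)})} = {1, 3}` and `v₃(c(W)) + v₃(c(W^{(d)})) = 1`.
-/

noncomputable section

open scoped Classical

open WeierstrassCurve IsLocalRing Polynomial
  Literature.NumberTheory.EllipticCurves Literature.NumberTheory.EllipticCurves.LocalIndex
  Literature.NumberTheory.DiophantineGeometry.TateAlgorithm

namespace Summit.BirchSwinnertonDyer.Rank1Residual.AdditivePotMult

namespace TypeIVTwistTwo

/-! ## Places of `ℚ` above `2` -/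

section RatPlace

open IsDedekindDomain NumberField Rat.HeightOneSpectrum

variable (W : WeierstrassCurve ℚ) [W.IsElliptic] (v : HeightOneSpectrum (𝓞 ℚ))

omit [W.IsElliptic] in
/-- The residue field of `𝒪_v` at the place of `ℚ` above `2` has two elements. [folklore] -/
private theorem natCard_residueField_eq_two (hv2 : (primesEquiv v : ℕ) = 2) :
    Nat.card (ResidueField (v.adicCompletionIntegers ℚ)) = 2 := by
  rw [IsDedekindDomain.HeightOneSpectrum.natCard_residueField_adicCompletionIntegers,
    ← Submodule.cardQuot_apply, ← Ideal.absNorm_apply,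
    Literature.NumberTheory.LFunctions.Chebotarev.absNorm_eq_primesEquiv, hv2]

/-- **The type-`IV` FLIP at the place of `ℚ` above `2`: `v₃(c_2(W)) + v₃(c_2(W^{(d)})) = 1`** for
`W/ℚ` with `kodairaSymbolAt v W = IV` (`v ∣ 2`) and `d = 4k + 1` with `k` ODD (`d ≡ 5 mod 8`:
`ℚ₂(√d)/ℚ₂` is the unramified quadratic extension) — the twist side of the INERT line of
(L_2)@3, the `ℓ = 2` entry left OUT of row T-MIL-B (there `ℓ ∤ 2·3·d_K`). Proof: §DVR flip over
`𝒪_v` (residue field `𝔽₂`) on the type-`IV` normal form of `W` at `v` and the tree's integral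
twist model (`exists_variableChange_twistModel_eq_quadraticTwist`, `isMinimal_twistModel`).
[cite: SilvermanATAEC1994, IV.9.4 Step 5 (PDF p. 344)] [cite: SilvermanAEC2009, X.5 Cor. 5.4] -/
theorem padicValNat_localTamagawaNumber_add_quadraticTwist_two_eq_one_of_kodairaSymbolAt_eq_IV
    (hv2 : (primesEquiv v : ℕ) = 2) {k : ℤ} (hk : Odd k) (hIV : W.kodairaSymbolAt v = .IV) :
    padicValNat 3 ((W.baseChange (v.adicCompletion ℚ)).localTamagawaNumber
        (v.adicCompletionIntegers ℚ)) +
      padicValNat 3 (((W.quadraticTwist (4 * k + 1 : ℚ)).baseChange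
        (v.adicCompletion ℚ)).localTamagawaNumber (v.adicCompletionIntegers ℚ)) = 1 := by
  set O := v.adicCompletionIntegers ℚ
  set Kv := v.adicCompletion ℚ
  haveI : (W.baseChange Kv).IsElliptic := by rw [baseChange]; infer_instance
  haveI : Finite (ResidueField O) := finite_residueField_adicCompletionIntegers_rat v
  haveI : PerfectField (ResidueField O) := PerfectField.ofFinite
  have hcard := natCard_residueField_eq_two v hv2
  -- `k` and `d = 4k + 1` are units of `𝒪_v` (both odd)
  have h2k : ¬ ((primesEquiv v : ℕ) : ℤ) ∣ k := by
    rw [hv2]; intro h; exact (Int.not_even_iff_odd.mpr hk) (even_iff_two_dvd.mpr (by exact_mod_cast h))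
  have h2d : ¬ ((primesEquiv v : ℕ) : ℤ) ∣ 4 * k + 1 := by
    rw [hv2]; intro h
    have : (2 : ℤ) ∣ 1 := by
      have h4 : (2 : ℤ) ∣ 4 * k := ⟨2 * k, by ring⟩
      exact (Int.dvd_add_right h4).mp (by exact_mod_cast h)
    omega
  have hku : IsUnit ((k : ℤ) : O) := isUnit_adicCompletionIntegers_intCast v h2k
  have hdu : IsUnit (4 * ((k : ℤ) : O) + 1) := by
    have := isUnit_adicCompletionIntegers_intCast v h2d
    simpa using this
  have hd0 : (4 * k + 1 : ℚ) ≠ 0 := by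
    intro h
    have : (4 * k + 1 : ℤ) = 0 := by exact_mod_cast h
    omega
  haveI : ((W.quadraticTwist (4 * k + 1 : ℚ)).baseChange Kv).IsElliptic := by
    haveI := W.isElliptic_quadraticTwist hd0
    rw [baseChange]; infer_instance
  -- the normal form at `v` and the twist model
  obtain ⟨J, D, γ, ε, hJ, hmin, h1, h2, hγ, h4, hε, hdisc⟩ :=
    TypeIVTwist.exists_normalForm_IV_of_kodairaSymbolAt_eq_IV v W hIV
  haveI := hmin
  set k₀ : O := ((k : ℤ) : O) with hk₀
  have hX : (J.twistModel k₀).baseChange Kv = (J.baseChange Kv).twistModel (algebraMap O Kv k₀) := by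
    rw [baseChange, map_twistModel]; rfl
  haveI hmin' : ((J.twistModel k₀).baseChange Kv).IsMinimal O := by
    rw [hX]; exact isMinimal_twistModel O (J.baseChange Kv) hdu
  haveI : NeZero (2 : Kv) := ⟨by
    rw [show (2 : Kv) = algebraMap ℚ Kv 2 from (map_ofNat _ 2).symm]
    exact (_root_.map_ne_zero _).mpr two_ne_zero⟩
  obtain ⟨C, -, hC⟩ :=
    exists_variableChange_twistModel_eq_quadraticTwist (J.baseChange Kv) (algebraMap O Kv k₀)
  have hdK : (4 * algebraMap O Kv k₀ + 1 : Kv) = algebraMap ℚ Kv (4 * k + 1 : ℚ) := by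
    rw [hk₀, map_intCast, map_add, map_mul, map_intCast, map_ofNat, map_one]
  have htw : (W.quadraticTwist (4 * k + 1 : ℚ)).baseChange Kv =
      (W.baseChange Kv).quadraticTwist (4 * algebraMap O Kv k₀ + 1) := by
    rw [baseChange, map_quadraticTwist, baseChange, hdK]
  have hJ' : (C⁻¹ * ⟨D.u, (4 * algebraMap O Kv k₀ + 1) * D.r, 0, 0⟩) •
      (W.quadraticTwist (4 * k + 1 : ℚ)).baseChange Kv = (J.twistModel k₀).baseChange Kv := by
    rw [htw, mul_smul, ← quadraticTwist_smul, hJ, ← hC, inv_smul_smul, hX]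
  exact padicValNat_localTamagawaNumber_add_twistModel_of_normalForm_IV hcard (W.baseChange Kv) J D
    hJ h1 h2 irreducible_uniformizer hγ h4 hε hdisc hku hdu _ _ hJ'


/-- **The type-`IV*` FLIP at the place of `ℚ` above `2`: `v₃(c_2(W)) + v₃(c_2(W^{(d)})) = 1`** for
`W/ℚ` with `kodairaSymbolAt v W = IV*` (`v ∣ 2`) and `d = 4k + 1` with `k` ODD (`d ≡ 5 mod 8`:
`ℚ₂(√d)/ℚ₂` is the unramified quadratic extension) — the twist side of the INERT line of
(L_2)@3, the `ℓ = 2` entry left OUT of row T-MIL-B (there `ℓ ∤ 2·3·d_K`). Proof: §DVR flip over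
`𝒪_v` (residue field `𝔽₂`) on the type-`IV*` normal form of `W` at `v` and the tree's integral
twist model (`exists_variableChange_twistModel_eq_quadraticTwist`, `isMinimal_twistModel`).
[cite: SilvermanATAEC1994, IV.9.4 Step 8 (PDF p. 346)] [cite: SilvermanAEC2009, X.5 Cor. 5.4] -/
theorem padicValNat_localTamagawaNumber_add_quadraticTwist_two_eq_one_of_kodairaSymbolAt_eq_IVstar
    (hv2 : (primesEquiv v : ℕ) = 2) {k : ℤ} (hk : Odd k) (hIV : W.kodairaSymbolAt v = .IVstar) :
    padicValNat 3 ((W.baseChange (v.adicCompletion ℚ)).localTamagawaNumber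
        (v.adicCompletionIntegers ℚ)) +
      padicValNat 3 (((W.quadraticTwist (4 * k + 1 : ℚ)).baseChange
        (v.adicCompletion ℚ)).localTamagawaNumber (v.adicCompletionIntegers ℚ)) = 1 := by
  set O := v.adicCompletionIntegers ℚ
  set Kv := v.adicCompletion ℚ
  haveI : (W.baseChange Kv).IsElliptic := by rw [baseChange]; infer_instance
  haveI : Finite (ResidueField O) := finite_residueField_adicCompletionIntegers_rat v
  haveI : PerfectField (ResidueField O) := PerfectField.ofFinite
  have hcard := natCard_residueField_eq_two v hv2
  -- `k` and `d = 4k + 1` are units of `𝒪_v` (both odd)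
  have h2k : ¬ ((primesEquiv v : ℕ) : ℤ) ∣ k := by
    rw [hv2]; intro h; exact (Int.not_even_iff_odd.mpr hk) (even_iff_two_dvd.mpr (by exact_mod_cast h))
  have h2d : ¬ ((primesEquiv v : ℕ) : ℤ) ∣ 4 * k + 1 := by
    rw [hv2]; intro h
    have : (2 : ℤ) ∣ 1 := by
      have h4 : (2 : ℤ) ∣ 4 * k := ⟨2 * k, by ring⟩
      exact (Int.dvd_add_right h4).mp (by exact_mod_cast h)
    omega
  have hku : IsUnit ((k : ℤ) : O) := isUnit_adicCompletionIntegers_intCast v h2k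
  have hdu : IsUnit (4 * ((k : ℤ) : O) + 1) := by
    have := isUnit_adicCompletionIntegers_intCast v h2d
    simpa using this
  have hd0 : (4 * k + 1 : ℚ) ≠ 0 := by
    intro h
    have : (4 * k + 1 : ℤ) = 0 := by exact_mod_cast h
    omega
  haveI : ((W.quadraticTwist (4 * k + 1 : ℚ)).baseChange Kv).IsElliptic := by
    haveI := W.isElliptic_quadraticTwist hd0
    rw [baseChange]; infer_instance
  -- the normal form at `v` and the twist model
  obtain ⟨J, D, γ, ε, hJ, hmin, h1, h2, hγ, h4, hε, hdisc⟩ :=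
    TypeIVTwist.exists_normalForm_IVstar_of_kodairaSymbolAt_eq_IVstar v W hIV
  haveI := hmin
  set k₀ : O := ((k : ℤ) : O) with hk₀
  have hX : (J.twistModel k₀).baseChange Kv = (J.baseChange Kv).twistModel (algebraMap O Kv k₀) := by
    rw [baseChange, map_twistModel]; rfl
  haveI hmin' : ((J.twistModel k₀).baseChange Kv).IsMinimal O := by
    rw [hX]; exact isMinimal_twistModel O (J.baseChange Kv) hdu
  haveI : NeZero (2 : Kv) := ⟨by
    rw [show (2 : Kv) = algebraMap ℚ Kv 2 from (map_ofNat _ 2).symm]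
    exact (_root_.map_ne_zero _).mpr two_ne_zero⟩
  obtain ⟨C, -, hC⟩ :=
    exists_variableChange_twistModel_eq_quadraticTwist (J.baseChange Kv) (algebraMap O Kv k₀)
  have hdK : (4 * algebraMap O Kv k₀ + 1 : Kv) = algebraMap ℚ Kv (4 * k + 1 : ℚ) := by
    rw [hk₀, map_intCast, map_add, map_mul, map_intCast, map_ofNat, map_one]
  have htw : (W.quadraticTwist (4 * k + 1 : ℚ)).baseChange Kv =
      (W.baseChange Kv).quadraticTwist (4 * algebraMap O Kv k₀ + 1) := by
    rw [baseChange, map_quadraticTwist, baseChange, hdK]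
  have hJ' : (C⁻¹ * ⟨D.u, (4 * algebraMap O Kv k₀ + 1) * D.r, 0, 0⟩) •
      (W.quadraticTwist (4 * k + 1 : ℚ)).baseChange Kv = (J.twistModel k₀).baseChange Kv := by
    rw [htw, mul_smul, ← quadraticTwist_smul, hJ, ← hC, inv_smul_smul, hX]
  exact padicValNat_localTamagawaNumber_add_twistModel_of_normalForm_IVstar hcard (W.baseChange Kv) J D
    hJ h1 h2 irreducible_uniformizer hγ h4 hε hdisc hku hdu _ _ hJ'

end RatPlace

/-! ## (T) at an INERT `2` of type `IV` / `IV*` (fibre-sum currency of C-3b) -/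

section Fibre

open TypeIVTwist IsDedekindDomain NumberField Rat.HeightOneSpectrum

variable (W : WeierstrassCurve ℚ) [W.IsElliptic] {K : Type} [Field K] [NumberField K]
  (Wd : WeierstrassCurve ℚ) (v : HeightOneSpectrum (𝓞 ℚ))

omit [W.IsElliptic] in
/-- `d ≡ 5 (mod 8)` means `d = 4k + 1` with `k` odd. [folklore] -/
private theorem exists_odd_eq_four_mul_add_one {d : ℤ} (hd : d % 8 = 5) :
    ∃ k : ℤ, Odd k ∧ d = 4 * k + 1 := by
  exact ⟨2 * (d / 8) + 1, ⟨d / 8, rfl⟩, by omega⟩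

/-- **(T) at the INERT place `2` of Kodaira type `IV`, `p = 3`** (`d_K ≡ 5 mod 8`): `W/ℚ`
elliptic, `[K:ℚ] = 2` with a single place `w` above `v ∣ 2`, `e = 1`, `f = 2`,
`W_d = C_d • W^{(d_K)}`: `Σ_{w ∣ v} v₃(c_w(W_K)) = v₃(3) = 1 = v₃(c_v(W)) + v₃(c_v(W_d))` — the
`K`-side by n1011-p08's `…_of_unramified_of_even` (whose only restriction is `ℓ ≠ 3`), the `ℚ`-side
by the `𝔽₂` flip `padicValNat_localTamagawaNumber_add_quadraticTwist_two_eq_one_of_kodairaSymbolAt_eq_IV`.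
The `ℓ = 2` line that row T-MIL-B left out and that T-MIL-3 carries as a proviso.
[cite: SilvermanATAEC1994, IV.9.4 Step 5 (PDF p. 344)] [cite: SilvermanAEC2009, Prop. VII.5.4 (a)] -/
theorem sum_fibre_padicValNat_localTamagawaNumber_of_kodairaSymbolAt_eq_IV_of_inert_two
    {Cd : VariableChange ℚ} (hWd : Cd • W.quadraticTwist (NumberField.discr K : ℚ) = Wd)
    (hd8 : NumberField.discr K % 8 = 5) (hv2 : (primesEquiv v : ℕ) = 2)
    (hIV : W.kodairaSymbolAt v = .IV) {w : HeightOneSpectrum (𝓞 K)}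
    (hset : {w' : HeightOneSpectrum (𝓞 K) | w'.under (𝓞 ℚ) = v} = {w})
    (he : w.asIdeal.ramificationIdx (𝓞 ℚ) = 1) (hf : w.asIdeal.inertiaDeg (𝓞 ℚ) = 2) :
    ∑ w ∈ (HeightOneSpectrum.finite_setOf_under_eq_of_numberField (K := K) v).toFinset,
        padicValNat 3 (((W.baseChange K).baseChange (w.adicCompletion K)).localTamagawaNumber
          (w.adicCompletionIntegers K)) =
      padicValNat 3 ((W.baseChange (v.adicCompletion ℚ)).localTamagawaNumber
          (v.adicCompletionIntegers ℚ)) +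
        padicValNat 3 ((Wd.baseChange (v.adicCompletion ℚ)).localTamagawaNumber
          (v.adicCompletionIntegers ℚ)) := by
  have hfin := HeightOneSpectrum.finite_setOf_under_eq_of_numberField (K := K) v
  have hw : w.under (𝓞 ℚ) = v := by
    have h : w ∈ ({w} : Set (HeightOneSpectrum (𝓞 K))) := Set.mem_singleton _
    rwa [← hset] at h
  have hF : hfin.toFinset = {w} := by
    ext w'
    rw [Set.Finite.mem_toFinset, hset]
    simp
  have hv3 : (primesEquiv v : ℕ) ≠ 3 := by rw [hv2]; norm_num
  obtain ⟨k, hk, hdk⟩ := exists_odd_eq_four_mul_add_one hd8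
  have hd : (NumberField.discr K : ℚ) ≠ 0 := by exact_mod_cast NumberField.discr_ne_zero K
  haveI := W.isElliptic_quadraticTwist hd
  have hcast : (NumberField.discr K : ℚ) = (4 * k + 1 : ℚ) := by rw [hdk]; push_cast; ring
  have key := padicValNat_localTamagawaNumber_add_quadraticTwist_two_eq_one_of_kodairaSymbolAt_eq_IV
    W v hv2 hk hIV
  rw [← hcast] at key
  rw [hF, Finset.sum_singleton,
    localTamagawaNumber_baseChange_eq_three_of_kodairaSymbolAt_eq_IV_of_unramified_of_even v W hv3 hIV
      hw he (by rw [hf]; exact even_two),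
    localTamagawaNumber_eq_of_variableChange_eq hWd v, key]
  simp

/-- **(T) at the INERT place `2` of Kodaira type `IV*`, `p = 3`** (`d_K ≡ 5 mod 8`) — Step-8 twin.
[cite: SilvermanATAEC1994, IV.9.4 Step 8 (PDF p. 346)] [cite: SilvermanAEC2009, Prop. VII.5.4 (a)] -/
theorem sum_fibre_padicValNat_localTamagawaNumber_of_kodairaSymbolAt_eq_IVstar_of_inert_two
    {Cd : VariableChange ℚ} (hWd : Cd • W.quadraticTwist (NumberField.discr K : ℚ) = Wd)
    (hd8 : NumberField.discr K % 8 = 5) (hv2 : (primesEquiv v : ℕ) = 2)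
    (hIV : W.kodairaSymbolAt v = .IVstar) {w : HeightOneSpectrum (𝓞 K)}
    (hset : {w' : HeightOneSpectrum (𝓞 K) | w'.under (𝓞 ℚ) = v} = {w})
    (he : w.asIdeal.ramificationIdx (𝓞 ℚ) = 1) (hf : w.asIdeal.inertiaDeg (𝓞 ℚ) = 2) :
    ∑ w ∈ (HeightOneSpectrum.finite_setOf_under_eq_of_numberField (K := K) v).toFinset,
        padicValNat 3 (((W.baseChange K).baseChange (w.adicCompletion K)).localTamagawaNumber
          (w.adicCompletionIntegers K)) =
      padicValNat 3 ((W.baseChange (v.adicCompletion ℚ)).localTamagawaNumber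
          (v.adicCompletionIntegers ℚ)) +
        padicValNat 3 ((Wd.baseChange (v.adicCompletion ℚ)).localTamagawaNumber
          (v.adicCompletionIntegers ℚ)) := by
  have hfin := HeightOneSpectrum.finite_setOf_under_eq_of_numberField (K := K) v
  have hw : w.under (𝓞 ℚ) = v := by
    have h : w ∈ ({w} : Set (HeightOneSpectrum (𝓞 K))) := Set.mem_singleton _
    rwa [← hset] at h
  have hF : hfin.toFinset = {w} := by
    ext w'
    rw [Set.Finite.mem_toFinset, hset]
    simp
  have hv3 : (primesEquiv v : ℕ) ≠ 3 := by rw [hv2]; norm_num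
  obtain ⟨k, hk, hdk⟩ := exists_odd_eq_four_mul_add_one hd8
  have hd : (NumberField.discr K : ℚ) ≠ 0 := by exact_mod_cast NumberField.discr_ne_zero K
  haveI := W.isElliptic_quadraticTwist hd
  have hcast : (NumberField.discr K : ℚ) = (4 * k + 1 : ℚ) := by rw [hdk]; push_cast; ring
  have key :=
    padicValNat_localTamagawaNumber_add_quadraticTwist_two_eq_one_of_kodairaSymbolAt_eq_IVstar W v hv2
      hk hIV
  rw [← hcast] at key
  rw [hF, Finset.sum_singleton,
    localTamagawaNumber_baseChange_eq_three_of_kodairaSymbolAt_eq_IVstar_of_unramified_of_even v W hv3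
      hIV hw he (by rw [hf]; exact even_two),
    localTamagawaNumber_eq_of_variableChange_eq hWd v, key]
  simp

end Fibre

end TypeIVTwistTwo

end Summit.BirchSwinnertonDyer.Rank1Residual.AdditivePotMult

end
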